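import Summits.NavierStokesRegularity.NavierStokesRegularity.Theorems.ExtremiserTransienceNearExtremalTransienceExtremiserLiouvilleConstantSpeedCalculus
import Literature.Analysis.FluidPDE.TaoEnstrophyLocalisationProofs
import HarnessLib

/-!
# Crux `ExtremiserTransience.NearExtremalTransience` (stmt-NavierStokesRegularity-21883), line `extremiser_liouville`,
# stub K1b — POINTWISE JET KINEMATICS FOR THE ABSORPTION LEDGER R6b (record §3/§15/§17)

`--supports stmt-NavierStokesRegularity-21883` (helper).  Author: prover seat `ns-el-k1b` (g9).

The absorption ledger R6b (record §15) controls the indefinite `V₂`-entries of the `W′`- and `Z′`-lines of (INEQ)₃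
(`…ConstantSpeedSlideInequalityLayer`; after `…SlideEnstrophyCoercive`, `…SlidePalinstrophyFrobenius`, `…SlidePalinstrophyCancellation`
these are `|∇_hV₂|²`, `⟪∇_hV₂,∂₂V_h⟫` and `|∇∇_hV₂|²`) by the KINEMATICS of a constant-speed field: for `‖v‖ ≡ M`, `c = (0,0,c₂)` with
`|c₂| = M` and `V = v − c`,
```
  2c₂V₂ = −‖V‖²,     c₂·∂ᵤV₂ = −⟪V, ∂ᵤV⟫,     c₂·(∂ᵤ∂ₑV)₂ = −(⟪∂ᵤV, ∂ₑV⟫ + ⟪V, ∂ᵤ∂ₑV⟫),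
```
hence `M|∇V₂| ≤ ‖V‖·|DV|` and `M|(D²V)₂| ≤ |DV|² + ‖V‖·|D²V|` pointwise — small where `‖V‖ ≤ σ ≪ M` (the far layer of the jet).
* `inner_fderiv_fderiv_add_inner_fderiv_fderiv_eq_zero` : `⟪∂ᵤv,∂ₑv⟫ + ⟪v, ∂ᵤ∂ₑv⟫ = 0` (constant speed, `C²`);
* `eq_coord_two_smul_single` : `c = c₂·e₂` when `c₀ = c₁ = 0`;
* `two_mul_coord_two_mul_sub_coord_two_eq`, `coord_two_mul_fderiv_apply_two_eq`, `coord_two_mul_fderiv_fderiv_apply_two_eq` : the three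
  displayed identities; `abs_coord_two_mul_fderiv_apply_two_le`, `abs_coord_two_mul_fderiv_fderiv_apply_two_le` : the two bounds.

WHAT THIS IS NOT: K1b is NOT proved; nothing here proves NS regularity. [folklore]
-/

noncomputable section

open Set Filter Topology MeasureTheory Metric Function InnerProductSpace
open scoped ENNReal NNReal Topology InnerProductSpace RealInnerProductSpace ContDiff
open Literature.Analysis.FluidPDE Literature.Analysis

namespace Summit.NavierStokesRegularity.NavierStokesRegularity.Theorems

-- the problem directory repeats the summit name (`NavierStokesRegularity/NavierStokesRegularity`)
set_option linter.dupNamespace false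

namespace ExtremiserLiouville

variable {v : EuclideanSpace ℝ (Fin 3) → EuclideanSpace ℝ (Fin 3)} {c : EuclideanSpace ℝ (Fin 3)} {M : ℝ}

/-! ## 1. Second-order constant-speed kinematics -/

/-- **`⟪∂ᵤv, ∂ₑv⟫ + ⟪v, ∂ᵤ∂ₑv⟫ = 0`** for a constant-speed `C²` field (differentiate `⟪v, ∂ₑv⟫ ≡ 0` in the direction `u`). [folklore] -/
theorem inner_fderiv_fderiv_add_inner_fderiv_fderiv_eq_zero (hv : ContDiff ℝ 2 v) (hM : ∀ x, ‖v x‖ = M) (x u e : EuclideanSpace ℝ (Fin 3)) :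
    ⟪fderiv ℝ v x u, fderiv ℝ v x e⟫ + ⟪v x, fderiv ℝ (fun y => fderiv ℝ v y e) x u⟫ = 0 := by
  have hv1 : Differentiable ℝ v := hv.differentiable (by norm_num)
  have hDe : Differentiable ℝ fun y => fderiv ℝ v y e :=
    ((hv.fderiv_right (m := 1) le_rfl).clm_apply contDiff_const).differentiable one_ne_zero
  have h := inner_fderiv_add_eq_zero_of_inner_const hv1 hDe (fun y => inner_fderiv_apply_eq_zero_of_norm_eq hv1 hM y e) x u
  linarith [real_inner_comm (fderiv ℝ v x u) (fderiv ℝ v x e)]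

/-! ## 2. The axial constant `c = (0, 0, c₂)` -/

/-- `c = c₂·e₂` when `c₀ = c₁ = 0`. [folklore] -/
theorem eq_coord_two_smul_single (hc0 : c 0 = 0) (hc1 : c 1 = 0) :
    c = (c 2) • EuclideanSpace.single (2 : Fin 3) (1 : ℝ) := by
  ext i
  fin_cases i <;> simp [hc0, hc1]

/-- `⟪c, z⟫ = c₂ z₂` when `c₀ = c₁ = 0`. [folklore] -/
theorem inner_eq_coord_two_mul (hc0 : c 0 = 0) (hc1 : c 1 = 0) (z : EuclideanSpace ℝ (Fin 3)) : ⟪c, z⟫ = c 2 * z 2 := by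
  conv_lhs => rw [eq_coord_two_smul_single hc0 hc1]
  rw [inner_smul_left, EuclideanSpace.inner_single_left]
  simp

/-! ## 3. The three identities and the two bounds -/

/-- **`2c₂V₂ = −‖V‖²`** for `V = v − c`, `‖v‖ ≡ M = ‖c‖`, `c = (0,0,c₂)`. [folklore] -/
theorem two_mul_coord_two_mul_sub_coord_two_eq (hM : ∀ x, ‖v x‖ = M) (hc0 : c 0 = 0) (hc1 : c 1 = 0) (hcM : ‖c‖ = M)
    (x : EuclideanSpace ℝ (Fin 3)) : 2 * c 2 * (v x - c) 2 = -‖v x - c‖ ^ 2 := by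
  have h1 : ‖v x‖ ^ 2 = ‖v x - c‖ ^ 2 + 2 * ⟪v x - c, c⟫ + ‖c‖ ^ 2 := by
    have : v x = (v x - c) + c := (sub_add_cancel _ _).symm
    conv_lhs => rw [this]
    rw [← real_inner_self_eq_norm_sq, ← real_inner_self_eq_norm_sq, ← real_inner_self_eq_norm_sq]
    rw [inner_add_left, inner_add_right, inner_add_right, real_inner_comm c (v x - c)]
    ring
  rw [hM, hcM, real_inner_comm, inner_eq_coord_two_mul hc0 hc1] at h1
  linarith

/-- **`c₂·(∂ᵤV)₂ = −⟪V, ∂ᵤV⟫`** (`V = v − c`, `DV = Dv`): from `⟪v, ∂ᵤv⟫ = 0`. [folklore] -/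
theorem coord_two_mul_fderiv_apply_two_eq (hv : Differentiable ℝ v) (hM : ∀ x, ‖v x‖ = M) (hc0 : c 0 = 0) (hc1 : c 1 = 0)
    (x u : EuclideanSpace ℝ (Fin 3)) : c 2 * fderiv ℝ v x u 2 = -⟪v x - c, fderiv ℝ v x u⟫ := by
  rw [inner_sub_left, inner_fderiv_apply_eq_zero_of_norm_eq hv hM x u, inner_eq_coord_two_mul hc0 hc1]
  ring

/-- **`c₂·(∂ᵤ∂ₑV)₂ = −(⟪∂ᵤV, ∂ₑV⟫ + ⟪V, ∂ᵤ∂ₑV⟫)`** (`V = v − c`): from `⟪∂ᵤv,∂ₑv⟫ + ⟪v,∂ᵤ∂ₑv⟫ = 0`. [folklore] -/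
theorem coord_two_mul_fderiv_fderiv_apply_two_eq (hv : ContDiff ℝ 2 v) (hM : ∀ x, ‖v x‖ = M) (hc0 : c 0 = 0) (hc1 : c 1 = 0)
    (x u e : EuclideanSpace ℝ (Fin 3)) :
    c 2 * fderiv ℝ (fun y => fderiv ℝ v y e) x u 2 =
      -(⟪fderiv ℝ v x u, fderiv ℝ v x e⟫ + ⟪v x - c, fderiv ℝ (fun y => fderiv ℝ v y e) x u⟫) := by
  have h := inner_fderiv_fderiv_add_inner_fderiv_fderiv_eq_zero hv hM x u e
  rw [inner_sub_left, inner_eq_coord_two_mul hc0 hc1]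
  linarith

/-- **`|c₂|·|(∂ᵤV)₂| ≤ ‖V‖·‖∂ᵤV‖`** — so `M|∇V₂| ≤ σ|DV|` where `‖V‖ ≤ σ`. [folklore] -/
theorem abs_coord_two_mul_fderiv_apply_two_le (hv : Differentiable ℝ v) (hM : ∀ x, ‖v x‖ = M) (hc0 : c 0 = 0) (hc1 : c 1 = 0)
    (x u : EuclideanSpace ℝ (Fin 3)) : |c 2| * |fderiv ℝ v x u 2| ≤ ‖v x - c‖ * ‖fderiv ℝ v x u‖ := by
  rw [← abs_mul, coord_two_mul_fderiv_apply_two_eq hv hM hc0 hc1, abs_neg]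
  exact abs_real_inner_le_norm _ _

/-- **`|c₂|·|(∂ᵤ∂ₑV)₂| ≤ ‖∂ᵤV‖‖∂ₑV‖ + ‖V‖·‖∂ᵤ∂ₑV‖`** — so `M|(D²V)₂| ≤ |DV|² + σ|D²V|` where `‖V‖ ≤ σ`. [folklore] -/
theorem abs_coord_two_mul_fderiv_fderiv_apply_two_le (hv : ContDiff ℝ 2 v) (hM : ∀ x, ‖v x‖ = M) (hc0 : c 0 = 0) (hc1 : c 1 = 0)
    (x u e : EuclideanSpace ℝ (Fin 3)) :
    |c 2| * |fderiv ℝ (fun y => fderiv ℝ v y e) x u 2| ≤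
      ‖fderiv ℝ v x u‖ * ‖fderiv ℝ v x e‖ + ‖v x - c‖ * ‖fderiv ℝ (fun y => fderiv ℝ v y e) x u‖ := by
  rw [← abs_mul, coord_two_mul_fderiv_fderiv_apply_two_eq hv hM hc0 hc1, abs_neg]
  exact (abs_add_le _ _).trans (add_le_add (abs_real_inner_le_norm _ _) (abs_real_inner_le_norm _ _))

/-! ## 4. The far layer of the jet is small -/

/-- **`σ(a) → 0`**: if `v → 0` at infinity then for every `ε > 0` there is a height `a` with `‖v x‖ ≤ ε` whenever `|x₂| ≥ a`
(the layer `{|x₂| ≥ a}` lies outside the ball of radius `a`).  This gives the smallness of `σ = sup_layer ‖v − c‖` (apply it to `v − c`) used by the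
absorption ledger R6b. [folklore] -/
theorem exists_forall_norm_le_of_le_abs_coord_two (hfar : Tendsto v (cocompact (EuclideanSpace ℝ (Fin 3))) (𝓝 0)) {ε : ℝ} (hε : 0 < ε) :
    ∃ a : ℝ, ∀ x : EuclideanSpace ℝ (Fin 3), a ≤ |x 2| → ‖v x‖ ≤ ε := by
  obtain ⟨K, hK, hKV⟩ := (hasBasis_cocompact.eventually_iff).1 (Metric.tendsto_nhds.1 hfar ε hε)
  obtain ⟨R, hR⟩ := hK.isBounded.subset_closedBall 0
  refine ⟨R + 1, fun x hx => ?_⟩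
  have hx2 : |x 2| ≤ ‖x‖ := by
    have h := PiLp.norm_apply_le (p := 2) x 2
    rwa [Real.norm_eq_abs] at h
  have hxK : x ∈ Kᶜ := by
    intro hmem
    have hb := hR hmem
    rw [Metric.mem_closedBall, dist_zero_right] at hb
    linarith
  have h := hKV hxK
  simp only [dist_zero_right] at h
  exact h.le

end ExtremiserLiouville

end Summit.NavierStokesRegularity.NavierStokesRegularity.Theorems

end
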